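import Mathlib
import HarnessLib
import Literature.Analysis.ODE.PoincareSection
import Summits.NavierStokesRegularity.NavierStokesRegularity.Theorems.TaylorModelRungThreeReadoutVTubeDerivWinP
import Summits.NavierStokesRegularity.NavierStokesRegularity.Theorems.TaylorModelRungThreeReadoutVLandBaseWinPCross
import Summits.NavierStokesRegularity.NavierStokesRegularity.Theorems.TaylorModelRungThreeReadoutVDyn
import Summits.NavierStokesRegularity.NavierStokesRegularity.Theorems.TaylorModelRungThreeReadoutVLandDeriv

/-!
# Line `taylor-model` on crux K1b-DR (stmt-NavierStokesRegularity-23954) — G-side assembly under the windowed v3 certificate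
# with POINCARÉ-CORRECTED base landing `ReadoutsVP`, part 1: K1b-DR's DYNAMIC block from `ValidVP`, the crux modulo the
# landing block, and the BASE LANDING inequality by the MEAN VALUE THEOREM THROUGH THE SECTION (ns-tm-g4 g7)

Ports of `…ReadoutVLandBaseWin` (`kBlockDynVW`, `k1bDR_of_validVW_of_land`) to `ReadoutsVP` / `ValidVP`
(`…VReadoutsWinPDefs`), and the ONE new proof of the (R9p) design (tm-g4 g6 memo `WINDOWED-READOUTS-23954.md` §R9p; tools in
`…ReadoutVLandBaseWinPCross`):

* `kBlockDynVWP`, `k1bDR_of_validVP_of_land` — verbatim ports;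
* **`baseLanding_ofVP`** — THE BASE LANDING inequality `|ℓ(land(φ(x₀)(τ(x₀))) v) − ctr| + β ≤ rad − s` from (R0) + (R9p): with
  `y* := φ(x₀)(Tn(S−1)) ∈ H⁰_{S−1}` and `g(σ) := ℓ(land(P(x_{S−1} + σ(y* − x_{S−1}))) v)` (`P` = Poincaré map of the last
  sub-step onto `{σf = lev}`; the segment consists of `NodeStart 1` states, the family is the last-sub-step flow from the
  level-1 hull box), the `C¹` Poincaré-map theorem (`Literature.Analysis.ODE.hasFDerivWithinAt_crossingTime_poincareMap`) and
  the landing calculus (`G2.hasDerivWithinAt_ell_land`) give `g′(σ) = ℓ(landD y_σ v (secCorr y_σ (kapp A_σ (y* − x_{S−1}))))`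
  with `y_σ ∈ Z¹ ∩ {σf = lev}` the member's crossing state and `A_σ` an in-step kernel at its crossing time (a time of the level-1
  window; `exists_inStepKerAt`); (R9p) bounds `|ℓ(land y_c v) − ctr| + |g′(σ)| + β ≤ rad − s` for every `σ` (`y_c ∈ Z⁰c` the
  centre's crossing state), `g(0) = ℓ(land y_c v)` and `g(1)` is the base landing (the member from `y*` crosses at K1b-DR's
  `tauSel`), and the scalar mean value theorem on `[0,1]` closes.

MODEL-lattice rung TL-M3 only; nothing here is a statement about the Navier–Stokes equations (K1b-DR is NOT proved here).
-/

noncomputable section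

-- the sub-problem namespace repeats the summit name by design (D-0017)
set_option linter.dupNamespace false

namespace Summit.NavierStokesRegularity.NavierStokesRegularity.Theorems.TaylorModelV

open Set Finset Metric
open Literature.Analysis.FluidPDE.TaoCascade Literature.Analysis.FluidPDE.TaoCascade.TaylorChain
open Summit.NavierStokesRegularity.NavierStokesRegularity.Theorems.TaylorModelMajorant
open Summit.NavierStokesRegularity.NavierStokesRegularity.Theorems.TaylorModelVector
open Summit.NavierStokesRegularity.NavierStokesRegularity.Theorems.TaylorModelReadout

variable {cd : CertData} {bx : StepBoxes} {rd : RadiiData} {ro : ReadoutData} {rw : WinData} {φ : Flow}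

/-! ### The dynamic block and the crux modulo the landing block -/

/-- **K1b-DR's dynamic block from a `ValidVP` certificate and a v3 flow package** (crossing time = `tauSel`). [folklore] -/
theorem kBlockDynVWP (hV : ValidVP cd bx rd ro rw) (hF : IsFlowPackageV cd bx φ) : KBlockDyn cd φ (tauSel cd φ) := by
  obtain ⟨hS, hSN, ⟨hC, hR⟩, hRO⟩ := hV
  have hwin : -cd.Kb ≤ cd.Ka := by
    have hKb : 0 ≤ cd.Kb := hS.2.2.2.2.2.2.2.2.2.2.1
    have hKa : 1 ≤ cd.Ka := hS.2.2.2.2.2.2.2.2.2.2.2.1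
    linarith
  have hPN := (polyInvariantV hC hR hF).1
  obtain ⟨hE1, hτ⟩ := kBlockE1_crossing_ofVWP hSN hC hF hRO hPN
  obtain ⟨hT, hL⟩ := kBlockTubeLip_ofVWP hSN hC hF hRO hwin hPN hτ
  exact kBlockDyn_of cd φ _ hE1 hT hL

/-- **K1b-DR modulo the landing block (`ValidVP`)**: the certificate plus the landing block `KBlockLand` for the SELECTOR
flow (at the crossing time `tauSel`) give `DerivativeEnclosureCertificateR`. [folklore] -/
theorem k1bDR_of_validVP_of_land (hV : ValidVP cd bx rd ro rw)
    (hL : KBlockLand cd (fun _ => liftFlow cd (fun x s => flowSel (Qw cd) x s))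
      (tauSel cd (fun _ => liftFlow cd (fun x s => flowSel (Qw cd) x s)))) :
    Summit.NavierStokesRegularity.NavierStokesRegularity.Theses.ExactWindowRungThree.DerivativeEnclosureCertificateR := by
  have hF : IsFlowPackageV cd bx (fun _ => liftFlow cd (fun x s => flowSel (Qw cd) x s)) :=
    isFlowPackageV_of_core hV.2.1 hV.2.2.1.1
  exact k1bDR_of_blocks cd hV.1 hV.2.1 _ _ (kBlockDynVWP hV hF) hL

/-! ### The base landing by the mean value theorem through the section -/

/-- **BASE LANDING (first half of `KBlockLand`) under `ReadoutsVP`**: the base point is in the polytope and its landing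
read-out at the crossing satisfies K1b-DR's inequality with allowance `β` — (R0) + (R9p) by the mean value theorem along the
segment from the centre `x_{S−1}` to the true base state `y* = φ(x₀)(Tn(S−1))` (module docstring).  Hypotheses: the certificate
predicates and `Static` (for `0 < τs`, used in `as > 0`, so that crossing states have `y i₀ 1 ≠ 0`). [folklore] -/
theorem baseLanding_ofVP (hSN : cd.StageNumerics) (hC : ChainVCore cd bx) (hR : ChainVRadii cd bx rd)
    (hF : IsFlowPackageV cd bx φ) (hRO : ReadoutsVP cd bx rd ro rw) {j : ℕ} (hj : j ≤ cd.N₀) (hSt : cd.Static) :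
    InPoly cd j (cd.x j 0) ∧ ∀ v : Fin 4 → ℝ, TailOK cd v → ∀ l,
      |cd.ℓ (cd.nx j) l (cd.land j (stAt φ j (cd.x j 0) (tauSel cd φ j (cd.x j 0))) v) - cd.ctr (cd.nx j) l| +
        cd.β j l ≤ cd.rad (cd.nx j) l - cd.s (cd.nx j) l := by
  -- ### data of the stage
  have hS : 1 ≤ cd.S j := (hC j hj).1
  have hs : cd.S j - 1 < cd.S j := Nat.sub_lt hS Nat.one_pos
  have hTs := ((gridV hC hj).2.1 _ hs).2
  rw [Nat.sub_add_cancel hS] at hTs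
  have hU := isUniqueFlow_of_packageV hF
  obtain ⟨-, hx0, hγ, -, hσw, -, -, -, -, -, -, -, -, hR7, hR8, hR9, -, -, hW1, -⟩ := hRO j hj
  obtain ⟨hu10, hu1u0, hu0, hu01, huh⟩ := hW1
  have hPI := (polyInvariantV hC hR hF).1 j hj
  obtain ⟨a, haY, haX⟩ := exists_sigmaCLM hσw
  -- `as > 0`, hence crossing states have `y i₀ 1 ≠ 0`
  have has : 0 < cd.as j := by
    obtain ⟨hnx, -, -, -, hΛ, hδ, hω, -, hmar, -⟩ := hSN.1 j hj
    have hLv : 1 ≤ cd.Lv (cd.nx j) := (hSN.1 _ hnx).2.1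
    have hτs : 0 < cd.τs := hSt.2.2.2.2.2.2.2.2.2.2.2.2.1
    have h2 : 0 < (2:ℝ) ^ (-cd.θ) := Real.rpow_pos_of_pos two_pos _
    have h3 : 0 ≤ cd.Λ j * cd.δ j * cd.τs * cd.ω j 1 := by
      have := hω 1; positivity
    nlinarith
  refine ⟨hx0, fun v hv l => ?_⟩
  -- ### the objects: last sub-step, centre `xc`, true base state `ys = y*`
  set s₁ := cd.S j - 1 with hs₁
  set hh := cd.h j s₁ with hhh
  set x₀ := cd.x j 0 with hx₀
  set xc := cd.x j s₁ with hxc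
  set ys := stAt φ j x₀ (cd.Tn j s₁) with hys
  have hysN : NodeStart cd bx j s₁ 0 ys := ((polyInvariantV hC hR hF).2 j hj hx0 _ hs.le).1
  have hysH0 : InBox cd (bx.hlo 0 j s₁) (bx.hhi 0 j s₁) ys := ((polyInvariantV hC hR hF).2 j hj hx0 _ hs.le).2
  have hysH1 : InBox cd (bx.hlo 1 j s₁) (bx.hhi 1 j s₁) ys := (hPI x₀ hx0).2 _ hs.le
  have hxcH1 : InBox cd (bx.hlo 1 j s₁) (bx.hhi 1 j s₁) xc := x_mem_hull hC hj hs.le 1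
  have hseg : ∀ σ ∈ Icc (0:ℝ) 1, InBox cd (bx.hlo 1 j s₁) (bx.hhi 1 j s₁) (xc + σ • (ys - xc)) :=
    fun σ hσ => segment_mem_hull1 hC hj hs.le hysN hσ
  -- ### the solution family of the last sub-step from the level-1 hull box (window coordinates)
  set H1 : Set (Fin (nW cd) → ℝ) := toVec cd '' {z | InBox cd (bx.hlo 1 j s₁) (bx.hhi 1 j s₁) z} with hH1
  set Sbox : Set (Fin (nW cd) → ℝ) := Icc (toVec cd (ro.ylo 1 j)) (toVec cd (ro.yhi 1 j)) with hSbox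
  set H2 : Set (Fin (nW cd) → ℝ) := Icc (toVec cd (bx.hlo 2 j s₁)) (toVec cd (bx.hhi 2 j s₁)) with hH2
  set f : (Fin (nW cd) → ℝ) → (Fin (nW cd) → ℝ) := fun x => Qw cd x x with hf
  set u : (Fin (nW cd) → ℝ) → ℝ → (Fin (nW cd) → ℝ) := fun n t => flowSel (Qw cd) n t with hu
  have hH1H2 : H1 ⊆ H2 := by
    rintro n ⟨z, hz, rfl⟩
    exact toVec_mem_Icc_of_bounds (cd := cd) (inBox_hull2_of_hull1 hC hj hs.le hz)
  have hut : ∀ z t, u (toVec cd z) t = toVec cd (stAt φ j z t) := fun z t => (toVec_stAt_eq_flowSel hF j z t).symm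
  have hsolH : ∀ z, InBox cd (bx.hlo 1 j s₁) (bx.hhi 1 j s₁) z → SolvesOn cd φ j z hh :=
    fun z hz => (((hF.2 j hj).2.2 _ hs).1 z (inBox_hull2_of_hull1 hC hj hs.le hz)).1
  have hYH : ∀ z, InBox cd (bx.hlo 1 j s₁) (bx.hhi 1 j s₁) z → ∀ t ∈ Icc 0 hh,
      InBox cd (ro.ylo 1 j) (ro.yhi 1 j) (stAt φ j z t) :=
    fun z hz t ht => stAt_mem_YWP hSN hC hF hRO hj 1 hz ht
  have hfam : Literature.Analysis.ODE.IsSolutionFamily f Sbox H1 hh u := by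
    refine ⟨fun n _ => flowSel_zero _, ?_, ?_⟩
    · rintro n ⟨z, hz, rfl⟩ t ht
      have h1 := hasDerivWithinAt_toVec_stAt (hsolH z hz) ht
      have e : (fun t => toVec cd (stAt φ j z t)) = u (toVec cd z) := by funext t; exact (hut z t).symm
      rw [e] at h1
      rw [hut z t]
      exact h1
    · rintro n ⟨z, hz, rfl⟩ t ht
      rw [hut z t]
      exact toVec_mem_Icc_of_bounds (cd := cd) (hYH z hz t ht)
  -- the field: continuous and bounded on `Sbox`
  obtain ⟨QB, hQB⟩ := exists_QwBundle cd
  obtain ⟨C, hC0, hCb⟩ := exists_norm_Q_le QB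
  have hfc : ContinuousOn f Sbox := by
    have hlip := lipschitzOnWith_quad QB hC0 hCb (R := max ‖toVec cd (ro.ylo 1 j)‖ ‖toVec cd (ro.yhi 1 j)‖)
      (le_max_of_le_left (norm_nonneg _))
    have e : (fun x => QB x x) = f := by funext x; rw [hf, hQB]
    rw [e] at hlip
    exact hlip.continuousOn.mono fun x hx => mem_closedBall_zero_iff.2 (norm_le_of_mem_Icc hx)
  obtain ⟨M, hM⟩ := isCompact_Icc.exists_bound_of_continuousOn hfc
  -- transversality along the family ((R7) on `Y¹`)
  have haf : ∀ y : Fin 4 → ℤ → ℝ, a (f (toVec cd y)) = cd.σf j (cd.Qb y y) := by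
    intro y; rw [haX, hf]; simp only; rw [ofVec_Qw_self]
  have hval : ∀ z t, a (u (toVec cd z) t) = cd.σf j (stAt φ j z t) := by
    intro z t; rw [hut, ← haY]
  have htr : ∀ n ∈ H1, ∀ t ∈ Icc 0 hh, 0 < a (f (u n t)) := by
    rintro n ⟨z, hz, rfl⟩ t ht
    rw [hut, haf]
    exact hγ.trans_le (hR7 _ (hYH z hz t ht))
  -- ### the crossing times on `H1`
  set sW : (Fin (nW cd) → ℝ) → ℝ := fun n => sInf {t : ℝ | 0 ≤ t ∧ t ≤ hh ∧ cd.lev j ≤ a (u n t)} with hsW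
  have hcross : ∀ z, InBox cd (bx.hlo 1 j s₁) (bx.hhi 1 j s₁) z →
      rw.ulo 1 j ≤ sW (toVec cd z) ∧ sW (toVec cd z) ≤ rw.uhi 1 j ∧
      cd.σf j (stAt φ j z (sW (toVec cd z))) = cd.lev j ∧
      (∀ t, 0 ≤ t → t < sW (toVec cd z) → cd.σf j (stAt φ j z t) < cd.lev j) ∧
      (∀ t, sW (toVec cd z) < t → t ≤ hh → cd.lev j < cd.σf j (stAt φ j z t)) ∧
      InBox cd (rw.zlo 1 j) (rw.zhi 1 j) (stAt φ j z (sW (toVec cd z))) := by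
    intro z hz
    obtain ⟨τ, hL, hrest⟩ := lastStep_crossingP hSN hC hF hRO hj hz
    have hset : {t : ℝ | 0 ≤ t ∧ t ≤ hh ∧ cd.lev j ≤ a (u (toVec cd z) t)} =
        {t : ℝ | 0 ≤ t ∧ t ≤ hh ∧ cd.lev j ≤ cd.σf j (stAt φ j z t)} := by
      ext t; simp only [Set.mem_setOf_eq, hval]
    have e : sW (toVec cd z) = τ := by
      show sInf {t : ℝ | 0 ≤ t ∧ t ≤ hh ∧ cd.lev j ≤ a (u (toVec cd z) t)} = τ
      rw [hset]; exact hL.csInf_eq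
    rw [e]; exact hrest
  have hsWm : ∀ n ∈ H1, sW n ∈ Icc 0 hh ∧ a (u n (sW n)) = cd.lev j := by
    rintro n ⟨z, hz, rfl⟩
    obtain ⟨h1, h2, h3, -⟩ := hcross z hz
    exact ⟨⟨hu10.trans h1, h2.trans huh⟩, by rw [hval]; exact h3⟩
  -- the member from `y*`: its crossing is K1b-DR's base crossing
  have hτ1 : u (toVec cd ys) (sW (toVec cd ys)) = toVec cd (stAt φ j x₀ (tauSel cd φ j x₀)) := by
    obtain ⟨h1, h2, h3, -, -, -⟩ := crossing_factsVWP hSN hC hF hRO hj (hPI x₀ hx0).1 (hPI x₀ hx0).2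
    have hmem : tauSel cd φ j x₀ - cd.Tn j s₁ ∈ Icc 0 hh := ⟨by linarith, by rw [hTs] at h2; linarith⟩
    have hstate : u (toVec cd ys) (tauSel cd φ j x₀ - cd.Tn j s₁) = toVec cd (stAt φ j x₀ (tauSel cd φ j x₀)) := by
      show flowSel (Qw cd) (toVec cd (stAt φ j x₀ (cd.Tn j s₁))) (tauSel cd φ j x₀ - cd.Tn j s₁) = _
      rw [node_flow_eq hC hR hF hj hx0 hmem, add_sub_cancel]
    have hlevv : cd.σf j (stAt φ j ys (tauSel cd φ j x₀ - cd.Tn j s₁)) = cd.lev j := by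
      rw [← hval, hstate, ← haY, h3]
    obtain ⟨-, -, -, hb, ha', -⟩ := hcross ys hysH1
    have e : sW (toVec cd ys) = tauSel cd φ j x₀ - cd.Tn j s₁ := by
      by_contra hne
      rcases lt_or_gt_of_ne hne with hlt | hgt
      · have := ha' _ hlt hmem.2
        linarith
      · have := hb _ hmem.1 hgt
        linarith
    rw [e]; exact hstate
  -- the member from the centre: its crossing state `yc` lies in `Z⁰c`
  obtain ⟨hc1, hc2, hc3, hcb, hca, -⟩ := hcross xc hxcH1
  set τc := sW (toVec cd xc) with hτc
  set yc := stAt φ j xc τc with hyc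
  obtain ⟨-, -, hycZ⟩ := centre_crossingP hSN hC hF hRO hj (hu10.trans hc1) (hc2.trans huh) hcb hca
  -- ### the read-out along the segment, its derivative and the (R9p) bound, pointwise in σ
  set g : ℝ → ℝ := fun σ' => cd.ℓ (cd.nx j) l
    (cd.land j (ofVec cd (u (toVec cd (xc + σ' • (ys - xc))) (sW (toVec cd (xc + σ' • (ys - xc)))))) v) with hg
  set T1 : ℝ := |cd.ℓ (cd.nx j) l (cd.land j yc v) - cd.ctr (cd.nx j) l| with hT1
  set Cst : ℝ := cd.rad (cd.nx j) l - cd.s (cd.nx j) l - cd.β j l - T1 with hCst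
  have hpt : ∀ σ ∈ Icc (0:ℝ) 1, ∃ yv : ℝ, HasDerivWithinAt g yv (Icc 0 1) σ ∧
      T1 + |yv| + cd.β j l ≤ cd.rad (cd.nx j) l - cd.s (cd.nx j) l := by
    intro σ hσ
    have hzH1 := hseg σ hσ
    have hzH2 : InBox cd (bx.hlo 2 j s₁) (bx.hhi 2 j s₁) (xc + σ • (ys - xc)) := inBox_hull2_of_hull1 hC hj hs.le hzH1
    set n₀ := toVec cd (xc + σ • (ys - xc)) with hn₀
    have hn₀W : n₀ ∈ H1 := Set.mem_image_of_mem _ hzH1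
    -- continuity in the start point, frozen-time derivative at the crossing time ((F9))
    have hcont : ∀ τ' ∈ Icc 0 hh, ContinuousWithinAt (fun n => u n τ') H1 n₀ := by
      intro τ' hτ'
      obtain ⟨L, hL, -, -⟩ := exists_fderiv_directional_of_core hSN hC hj hs hzH2 hτ'
      exact (hL.continuousWithinAt).mono hH1H2
    obtain ⟨hs0, -⟩ := hsWm n₀ hn₀W
    obtain ⟨J, A, hJ, hAker, hJA⟩ := exists_inStepKerAt hSN hC hj hs hzH2 hs0
    obtain ⟨-, hDP⟩ := Literature.Analysis.ODE.hasFDerivWithinAt_crossingTime_poincareMap hfam hM hfc htr hsWm hn₀W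
      hcont (hJ.mono hH1H2)
    -- the segment in window coordinates and the composite
    have hseg' : HasDerivWithinAt (fun σ' : ℝ => toVec cd (xc + σ' • (ys - xc))) (toVec cd (ys - xc)) (Icc 0 1) σ := by
      have h1 := ((hasDerivWithinAt_id σ (Icc (0:ℝ) 1)).smul_const (toVec cd (ys - xc))).const_add (toVec cd xc)
      rw [one_smul] at h1
      exact h1
    have hmaps : MapsTo (fun σ' : ℝ => toVec cd (xc + σ' • (ys - xc))) (Icc (0:ℝ) 1) H1 :=
      fun σ' hσ' => Set.mem_image_of_mem _ (hseg σ' hσ')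
    have hp : HasDerivWithinAt
        (fun σ' : ℝ => u (toVec cd (xc + σ' • (ys - xc))) (sW (toVec cd (xc + σ' • (ys - xc)))))
        ((J - (a (f (u n₀ (sW n₀))))⁻¹ • (a.comp J).smulRight (f (u n₀ (sW n₀)))) (toVec cd (ys - xc)))
        (Icc 0 1) σ := by
      have h := hDP.comp_hasDerivWithinAt σ hseg' hmaps
      exact h
    -- the crossing state `y` of the member and its read-out data ((W4p) ⇒ `y ∈ Z¹`, (R8w) ⇒ `y i₀ 1 ≠ 0`)
    obtain ⟨hw1, hw2, hσy, -, -, hyZ⟩ := hcross _ hzH1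
    set y := stAt φ j (xc + σ • (ys - xc)) (sW n₀) with hy
    have hp0 : u n₀ (sW n₀) = toVec cd y := hut _ _
    have hyne : y cd.i₀ 1 ≠ 0 := by
      have h1 := (hR8 _ hyZ hσy).1
      intro h0; rw [h0, abs_zero] at h1; linarith
    rw [hp0] at hp
    have h0' : ofVec cd (u (toVec cd (xc + σ • (ys - xc))) (sW (toVec cd (xc + σ • (ys - xc))))) cd.i₀ 1 ≠ 0 := by
      rw [hut, ofVec_toVec_of_wsupp cd (wsupp_stAtU hU hj _ _)]
      exact hyne
    -- ### the landing calculus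
    have hland := G2.hasDerivWithinAt_ell_land cd j (cd.nx j) l v hp h0'
    refine ⟨_, hland, ?_⟩
    -- ### the direction is `secCorr y (kapp A (y* − xc))`
    set w := toVec cd (ys - xc) with hw
    have hJw : ofVec cd (J w) = kapp cd A (ys - xc) := by
      refine eq_of_wsupp_of_window (wsupp_ofVec cd _) (wsupp_kapp _ _) fun i' k' hk1' hk2' => ?_
      rw [ofVec_apply_of_mem cd _ i' ⟨hk1', hk2'⟩, hJA w i' k' ⟨hk1', hk2'⟩]
      exact congrFun (congrFun (kapp_congr A (fun i k hk1 hk2 => by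
        rw [hw, ofVec_toVec, trunc_apply, if_pos ⟨hk1, hk2⟩])) i') k'
    have hdir : ofVec cd ((J - (a (f (toVec cd y)))⁻¹ • (a.comp J).smulRight (f (toVec cd y))) (toVec cd (ys - xc)))
        = secCorr cd j y (kapp cd A (ys - xc)) := by
      have e1 : (J - (a (f (toVec cd y)))⁻¹ • (a.comp J).smulRight (f (toVec cd y))) (toVec cd (ys - xc))
          = J w - (a (f (toVec cd y)))⁻¹ • ((a (J w)) • f (toVec cd y)) := by
        simp only [ContinuousLinearMap.coe_comp, Function.comp_apply, FunLike.coe_sub, Pi.sub_apply,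
          FunLike.coe_smul, Pi.smul_apply, ContinuousLinearMap.smulRight_apply, ← hw]
      rw [e1, ofVec_sub, ofVec_smul, ofVec_smul, haf, haX (J w), hJw]
      have e2 : ofVec cd (f (toVec cd y)) = cd.Qb y y := by simp only [hf]; exact ofVec_Qw_self y
      rw [e2, secCorr, smul_smul, inv_mul_eq_div]
    rw [hut, ofVec_toVec_of_wsupp cd (wsupp_stAtU hU hj _ _), hdir]
    -- ### the (R9p) bound with `yc`, `y₁ := y`, `A`, `y₀ := y*`
    exact hR9 yc hycZ hc3 y hyZ hσy _ ⟨hw1, hw2⟩ A hAker ys hysH0 v hv l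
  -- ### the mean value theorem on `[0,1]`
  classical
  obtain ⟨ψ, hψ⟩ : ∃ ψ : ℝ → ℝ, ∀ σ ∈ Icc (0:ℝ) 1, HasDerivWithinAt g (ψ σ) (Icc 0 1) σ ∧
      T1 + |ψ σ| + cd.β j l ≤ cd.rad (cd.nx j) l - cd.s (cd.nx j) l :=
    ⟨fun σ => if hσ : σ ∈ Icc (0:ℝ) 1 then Classical.choose (hpt σ hσ) else 0, fun σ hσ => by
      simp only [dif_pos hσ]
      exact Classical.choose_spec (hpt σ hσ)⟩
  have hMVT := (convex_Icc (0:ℝ) 1).norm_image_sub_le_of_norm_hasDerivWithin_le (f := g) (C := Cst)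
    (fun σ hσ => (hψ σ hσ).1)
    (fun σ hσ => by rw [Real.norm_eq_abs]; linarith [(hψ σ hσ).2])
    (left_mem_Icc.2 zero_le_one) (right_mem_Icc.2 zero_le_one)
  rw [sub_zero, norm_one, mul_one, Real.norm_eq_abs] at hMVT
  -- `g 1` is the base landing, `g 0` the centre's landing
  have hg1 : g 1 = cd.ℓ (cd.nx j) l (cd.land j (stAt φ j x₀ (tauSel cd φ j x₀)) v) := by
    show cd.ℓ (cd.nx j) l (cd.land j (ofVec cd (u (toVec cd (xc + (1:ℝ) • (ys - xc)))
      (sW (toVec cd (xc + (1:ℝ) • (ys - xc)))))) v) = _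
    rw [one_smul, add_sub_cancel, hτ1, ofVec_toVec_of_wsupp cd (wsupp_stAtU hU hj _ _)]
  have hg0 : g 0 = cd.ℓ (cd.nx j) l (cd.land j yc v) := by
    show cd.ℓ (cd.nx j) l (cd.land j (ofVec cd (u (toVec cd (xc + (0:ℝ) • (ys - xc)))
      (sW (toVec cd (xc + (0:ℝ) • (ys - xc)))))) v) = _
    rw [zero_smul, add_zero, hut, ofVec_toVec_of_wsupp cd (wsupp_stAtU hU hj _ _)]
  rw [hg1, hg0] at hMVT
  have htri := abs_sub_le (cd.ℓ (cd.nx j) l (cd.land j (stAt φ j x₀ (tauSel cd φ j x₀)) v))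
    (cd.ℓ (cd.nx j) l (cd.land j yc v)) (cd.ctr (cd.nx j) l)
  linarith [htri, hMVT, hCst, hT1]

end Summit.NavierStokesRegularity.NavierStokesRegularity.Theorems.TaylorModelV

end
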